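/-
Copyright (c) 2026 the pub-hodgecm-mathlib formalisation cell (harness21).  Prover seat hodgecm-mathlib-K2E1-p12 (g2), Track B ∕ K2-LIT, h413 = `stmt-HodgeConjecture-24833`,
line `K2_E1_TraceFormulaBeta`, dealer K2E1-plan (g7) (232)∕(238) «F3d-α», file α-0 (idelic preliminaries): the RETRACTION of the idele class group onto its norm-one subgroup
killing the archimedean ray, and the dictionary «unitary characters of `C_E¹` ↦ Hecke characters trivial on the ray».  No automorphic objects.
-/
import Literature.NumberTheory.Automorphic.IdeleClassGroupProofs                    -- ★ `continuous_ideleNorm_holds`, `ideleNorm_posRealIdele_holds`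
import Literature.NumberTheory.Automorphic.IdeleClassGroupCompactProofs             -- ★ `IdeleClassGroup.isCompact_normOne_holds` (`C_E¹` compact)
import Literature.NumberTheory.Automorphic.IdeleClassGroupAutomorphicQuotientProofs  -- ★ `continuous_posRealIdele`
import Mathlib.Analysis.SpecialFunctions.Pow.Continuity
import HarnessLib

/-!
# K2·E1 — `K2E1NormOneIdeleClassRetractionU` (F3d-α, file α-0): the continuous retraction `ρ : C_E → C_E¹`, `x ↦ x · [r_∞(‖x‖^{−1∕[E:ℚ]})]`, and Hecke characters
# trivial on the archimedean ray from unitary characters of the compact group `C_E¹`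

Track B ∕ K2-LIT, crux h413 = `stmt-HodgeConjecture-24833`, route `HCCMUnconditional`; cell `hodgecm-mathlib`, squad K2, ENGINE E1, ROADCARD C7 «families» (K2E1-p10 (g2)'s F3 split;
F3d-α dealt to this seat by (232)∕(238)).  THEOREMS ONLY (no `def`, no `instance`, no notation, no named-fact hypothesis, no `sorry`); lane `--supports stmt-HodgeConjecture-24833 --as
helper` (count-neutral).  Closes no socket.  Generic number field `E`.

THE MATHEMATICS ([WeilBNT1967, Ch. IV §4]; [CasselsFrohlichANT1967, Ch. II §16]).  The idele class group splits topologically as `C_E = C_E¹ × r_∞(ℝ_{>0})` (★ `normOne_inf_posReal_eq_bot`,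
`normOne_sup_posReal_eq_top`); the idelic norm is continuous (★) and `‖r_∞(t)‖ = t^{[E:ℚ]}` (★ `ideleNorm_posRealIdele_holds`), so
`ρ(x) := x · [r_∞(‖x‖^{−1∕[E:ℚ]})]` is a CONTINUOUS HOMOMORPHISM `C_E → C_E` with values in `C_E¹`, the identity on `C_E¹`, killing the ray (§1).  Composing a continuous unitary character
`χ₀` of the compact abelian group `C_E¹` with `ρ` gives a Hecke character `χ` of `E` (★ `HeckeCharacter.ofIdeleClassCharacter`) with `χ ∘ r_∞ = 1` and `χ = χ₀` on norm-one classes (§2) —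
the dictionary the family decomposition F3d (K2E1-p10 (g2)) indexes its isotypic pieces by.
* §1 `exists_normOne_retraction` — `∃ ρ : C_E →ₜ* C_E, (∀ x, ρ x ∈ C_E¹) ∧ (∀ x ∈ C_E¹, ρ x = x) ∧ ∀ r, ρ [r_∞ r] = 1`.
* §2 **`exists_heckeCharacter_of_normOne_character`** — for `χ₀ : C_E¹ →ₜ* Circle`: `∃ χ : HeckeCharacter E, (∀ r, χ (r_∞ r) = 1) ∧ ∀ x ∈ 𝕀_E, [x] ∈ C_E¹ → (χ x : ℂ) = χ₀ ⟨[x], _⟩`;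
  `compactSpace_normOne` (the instance-free `CompactSpace ↥C_E¹` statement, ★ `isCompact_normOne_holds`).
HONEST LABEL: HC_CM is proved only modulo the 7 printed citations (2 remaining named inputs: hLiu418 = `stmt-HodgeConjecture-24832`, h413 = `stmt-HodgeConjecture-24833`) until rung 0
closes; this file is letter-free and closes no socket.
References: [WeilBNT1967] A. Weil, *Basic Number Theory*, Ch. IV §4 · [CasselsFrohlichANT1967] Ch. II §16 · [TateThesis1967] §4.3.
-/

set_option autoImplicit false
-- the mandated namespace repeats the single-problem summit's segment (`HodgeConjecture.HodgeConjecture`)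
set_option linter.dupNamespace false

noncomputable section

open NumberField IsDedekindDomain Set Filter Topology
open scoped NNReal
open Literature.NumberTheory.Automorphic Literature.NumberTheory.GaloisRepresentations

namespace Summit.HodgeConjecture.HodgeConjecture.Cruxes.H413.K2E1NormOneIdeleClassRetractionU

variable (E : Type) [Field E] [NumberField E]

/-! ## §1 The retraction onto the norm-one classes -/

/-- The `d`-th root on `ℝ≥0ˣ` as a homomorphism (`d ≠ 0`): `r ↦ r^{1∕d}`, continuous, with `(r^{1∕d})^d = r` and `(r^d)^{1∕d} = r`. [folklore] -/
theorem exists_rootHom {d : ℕ} (hd : d ≠ 0) :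
    ∃ φ : ℝ≥0ˣ →* ℝ≥0ˣ, Continuous φ ∧ (∀ r : ℝ≥0ˣ, ((φ r : ℝ≥0ˣ) : ℝ≥0) ^ d = r) ∧ ∀ r : ℝ≥0ˣ, φ (r ^ d) = r := by
  have hne : ∀ r : ℝ≥0ˣ, ((r : ℝ≥0) ^ ((d : ℝ)⁻¹)) ≠ 0 := fun r => (NNReal.rpow_pos r.ne_zero.bot_lt).ne'
  set φ : ℝ≥0ˣ →* ℝ≥0ˣ := MonoidHom.mk' (fun r => Units.mk0 ((r : ℝ≥0) ^ ((d : ℝ)⁻¹)) (hne r))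
    (fun a b => Units.ext (by simp only [Units.val_mk0, Units.val_mul, NNReal.mul_rpow])) with hφ
  have hφv : ∀ r : ℝ≥0ˣ, ((φ r : ℝ≥0ˣ) : ℝ≥0) = (r : ℝ≥0) ^ ((d : ℝ)⁻¹) := fun r => rfl
  refine ⟨φ, ?_, fun r => ?_, fun r => ?_⟩
  · refine Units.continuous_iff.2 ⟨?_, ?_⟩
    · show Continuous fun r : ℝ≥0ˣ => ((φ r : ℝ≥0ˣ) : ℝ≥0)
      simp_rw [hφv]
      exact (NNReal.continuous_rpow_const (by positivity)).comp Units.continuous_val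
    · show Continuous fun r : ℝ≥0ˣ => (((φ r)⁻¹ : ℝ≥0ˣ) : ℝ≥0)
      have h : ∀ r : ℝ≥0ˣ, (((φ r)⁻¹ : ℝ≥0ˣ) : ℝ≥0) = ((r : ℝ≥0) ^ ((d : ℝ)⁻¹))⁻¹ := fun r => by rw [Units.val_inv_eq_inv_val, hφv]
      simp_rw [h]
      exact ((NNReal.continuous_rpow_const (by positivity)).comp Units.continuous_val).inv₀ hne
  · rw [hφv]
    exact NNReal.rpow_inv_natCast_pow _ hd
  · refine Units.ext ?_
    rw [hφv, Units.val_pow_eq_pow_val, NNReal.pow_rpow_inv_natCast _ hd]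

/-- The class-group norm is continuous (★ `continuous_ideleNorm_holds` descended along the open quotient map). [cite: WeilBNT1967, Ch. IV §4] -/
theorem continuous_norm : Continuous (IdeleClassGroup.norm E) :=
  (QuotientGroup.isOpenQuotientMap_mk (N := principalIdeles E)).continuous_comp_iff.1 (continuous_ideleNorm_holds E)

/-- **THE RETRACTION `ρ : C_E →ₜ* C_E` ONTO THE NORM-ONE CLASSES, KILLING THE RAY**: `ρ x := x · [r_∞(‖x‖^{−1∕[E:ℚ]})]` is a continuous homomorphism with `ρ x ∈ C_E¹` for all `x`,
`ρ x = x` for `x ∈ C_E¹`, and `ρ [r_∞ r] = 1` (★ `continuous_ideleNorm_holds`, ★ `ideleNorm_posRealIdele_holds`, ★ `continuous_posRealIdele`). [cite: WeilBNT1967, Ch. IV §4] -/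
theorem exists_normOne_retraction :
    ∃ ρ : IdeleClassGroup E →ₜ* IdeleClassGroup E, (∀ x, ρ x ∈ IdeleClassGroup.normOne E) ∧ (∀ x ∈ IdeleClassGroup.normOne E, ρ x = x) ∧
      ∀ r : ℝ≥0ˣ, ρ ((posRealIdele E r : ideleGroup E) : IdeleClassGroup E) = 1 := by
  have hd0 : Module.finrank ℚ E ≠ 0 := Module.finrank_pos.ne'
  obtain ⟨φ, hφc, hφd, hφinv⟩ := exists_rootHom hd0
  -- the norm on classes, as a units-valued homomorphism, and its continuity
  set nU : IdeleClassGroup E →* ℝ≥0ˣ := (IdeleClassGroup.norm E).toHomUnits with hnU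
  have hnUv : ∀ x : IdeleClassGroup E, ((nU x : ℝ≥0ˣ) : ℝ≥0) = IdeleClassGroup.norm E x := fun x => rfl
  have hnc : Continuous nU := by
    refine Units.continuous_iff.2 ⟨?_, ?_⟩
    · show Continuous fun x : IdeleClassGroup E => ((nU x : ℝ≥0ˣ) : ℝ≥0)
      simp_rw [hnUv]; exact continuous_norm E
    · show Continuous fun x : IdeleClassGroup E => (((nU x)⁻¹ : ℝ≥0ˣ) : ℝ≥0)
      have h : ∀ x : IdeleClassGroup E, (((nU x)⁻¹ : ℝ≥0ˣ) : ℝ≥0) = (IdeleClassGroup.norm E x)⁻¹ := fun x => by rw [Units.val_inv_eq_inv_val, hnUv]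
      simp_rw [h]
      exact (continuous_norm E).inv₀ fun x => by rw [← hnUv]; exact (nU x).ne_zero
  -- the correcting ray `x ↦ [r_∞((‖x‖^{1/d})⁻¹)]` and the retraction `ρ x = x · ray x`
  set ray : IdeleClassGroup E →* IdeleClassGroup E :=
    MonoidHom.mk' (fun x => (((posRealIdele E (φ (nU x))⁻¹ : ideleGroup E)) : IdeleClassGroup E))
      (fun x y => by rw [map_mul, map_mul, mul_inv, map_mul, QuotientGroup.mk_mul]) with hray
  have hray_apply : ∀ x : IdeleClassGroup E, ray x = ((posRealIdele E (φ (nU x))⁻¹ : ideleGroup E) : IdeleClassGroup E) := fun x => rfl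
  have hrayc : Continuous ray := by
    change Continuous fun x : IdeleClassGroup E => (((posRealIdele E (φ (nU x))⁻¹ : ideleGroup E)) : IdeleClassGroup E)
    exact QuotientGroup.continuous_mk.comp ((continuous_posRealIdele E).comp ((hφc.comp hnc).inv))
  set ρ : IdeleClassGroup E →* IdeleClassGroup E := MonoidHom.mk' (fun x => x * ray x) (fun x y => by rw [map_mul]; exact mul_mul_mul_comm x y (ray x) (ray y)) with hρ
  have hρ_apply : ∀ x, ρ x = x * ray x := fun x => rfl
  have hρc : Continuous ρ := by
    change Continuous fun x => ρ x
    simp_rw [hρ_apply]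
    exact continuous_id.mul hrayc
  refine ⟨{ toMonoidHom := ρ, continuous_toFun := hρc }, fun x => ?_, fun x hx => ?_, fun r => ?_⟩
  · -- norm of `x · ray x` is `1`
    show ρ x ∈ IdeleClassGroup.normOne E
    rw [IdeleClassGroup.mem_normOne_iff, hρ_apply, map_mul, hray_apply, IdeleClassGroup.norm_mk, map_inv, map_inv, ideleNorm_posRealIdele_holds E, hφd,
      ← hnUv, mul_inv_cancel₀ (nU x).ne_zero]
  · -- on norm-one classes the correction is trivial
    show ρ x = x
    have h1 : nU x = 1 := Units.ext ((IdeleClassGroup.mem_normOne_iff).1 hx)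
    rw [hρ_apply, hray_apply, h1, map_one, inv_one, map_one]
    exact mul_one x
  · -- the ray is killed
    show ρ _ = 1
    have h1 : nU ((posRealIdele E r : ideleGroup E) : IdeleClassGroup E) = r ^ Module.finrank ℚ E :=
      Units.ext (by rw [hnUv, IdeleClassGroup.norm_mk, ideleNorm_posRealIdele_holds E, Units.val_pow_eq_pow_val])
    rw [hρ_apply, hray_apply, h1, hφinv, ← QuotientGroup.mk_mul, ← map_mul, mul_inv_cancel, map_one]
    rfl

/-! ## §2 The compact group `C_E¹` and the dictionary with Hecke characters trivial on the ray -/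

/-- **`C_E¹` is compact** (★ `IdeleClassGroup.isCompact_normOne_holds`, as the `CompactSpace` statement on the subtype). [cite: WeilBNT1967, Ch. IV §4 Thm. 6] -/
theorem compactSpace_normOne : CompactSpace ↥(IdeleClassGroup.normOne E) :=
  isCompact_iff_compactSpace.1 (IdeleClassGroup.isCompact_normOne_holds E)

/-- **UNITARY CHARACTERS OF `C_E¹` ARE RESTRICTIONS OF HECKE CHARACTERS TRIVIAL ON THE RAY**: for every continuous `χ₀ : C_E¹ →* S¹` there is a Hecke character `χ` of `E` with `χ (r_∞ r) = 1`
for all `r > 0` and `χ x = χ₀ [x]` for every norm-one idele class `[x]` — `χ := χ₀ ∘ ρ` with the retraction of §1 (★ `HeckeCharacter.ofIdeleClassCharacter`).  The family decomposition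
(ROADCARD C7) indexes its isotypic pieces by these `χ`. [cite: WeilBNT1967, Ch. IV §4] [cite: TateThesis1967, §4.3] -/
theorem exists_heckeCharacter_of_normOne_character (χ₀ : ↥(IdeleClassGroup.normOne E) →ₜ* Circle) :
    ∃ χ : HeckeCharacter E, (∀ r : ℝ≥0ˣ, χ (posRealIdele E r) = 1) ∧
      ∀ (x : ideleGroup E) (hx : (x : IdeleClassGroup E) ∈ IdeleClassGroup.normOne E), ((χ x : ℂˣ) : ℂ) = ((χ₀ ⟨(x : IdeleClassGroup E), hx⟩ : Circle) : ℂ) := by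
  obtain ⟨ρ, hρ1, hρid, hρray⟩ := exists_normOne_retraction E
  -- `ψ := toUnits ∘ χ₀ ∘ ρ` as a continuous homomorphism `C_E →ₜ* ℂˣ`
  set ρ' : IdeleClassGroup E →* ↥(IdeleClassGroup.normOne E) := ρ.toMonoidHom.codRestrict (IdeleClassGroup.normOne E) hρ1 with hρ'
  have hρ'c : Continuous ρ' := ρ.continuous.subtype_mk _
  set ψm : IdeleClassGroup E →* ℂˣ := Circle.toUnits.comp (χ₀.toMonoidHom.comp ρ') with hψm
  have hψm_apply : ∀ x, ψm x = Circle.toUnits (χ₀ (ρ' x)) := fun x => rfl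
  have htu : Continuous (Circle.toUnits : Circle → ℂˣ) := by
    refine Units.continuous_iff.2 ⟨?_, ?_⟩
    · show Continuous fun z : Circle => ((Circle.toUnits z : ℂˣ) : ℂ)
      simp_rw [Circle.toUnits_apply, Units.val_mk0]
      exact continuous_subtype_val
    · show Continuous fun z : Circle => (((Circle.toUnits z)⁻¹ : ℂˣ) : ℂ)
      simp_rw [Units.val_inv_eq_inv_val, Circle.toUnits_apply, Units.val_mk0]
      exact continuous_subtype_val.inv₀ fun z : Circle => Circle.coe_ne_zero z
  have hψc : Continuous ψm := by
    change Continuous fun x => ψm x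
    simp_rw [hψm_apply]
    exact htu.comp (χ₀.continuous.comp hρ'c)
  set ψ : IdeleClassGroup E →ₜ* ℂˣ := { toMonoidHom := ψm, continuous_toFun := hψc } with hψ
  have hψ_apply : ∀ x, ψ x = Circle.toUnits (χ₀ (ρ' x)) := fun x => rfl
  refine ⟨HeckeCharacter.ofIdeleClassCharacter ψ, fun r => ?_, fun x hx => ?_⟩
  · apply Units.ext
    rw [HeckeCharacter.ofIdeleClassCharacter_apply, hψ_apply]
    have h1 : ρ' ((posRealIdele E r : ideleGroup E) : IdeleClassGroup E) = 1 := Subtype.ext (hρray r)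
    rw [h1, map_one, map_one]
  · rw [HeckeCharacter.ofIdeleClassCharacter_apply, hψ_apply]
    have h1 : ρ' (x : IdeleClassGroup E) = ⟨(x : IdeleClassGroup E), hx⟩ := Subtype.ext (hρid _ hx)
    rw [h1, Circle.toUnits_apply, Units.val_mk0]

end Summit.HodgeConjecture.HodgeConjecture.Cruxes.H413.K2E1NormOneIdeleClassRetractionU

end
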